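import Summits.BirchSwinnertonDyer.BirchSwinnertonDyer.Theorems.ErratumRoadFiveEulerHalfGenusLabels
import Summits.BirchSwinnertonDyer.BirchSwinnertonDyer.Theorems.ErratumRoadFiveEulerHalfGenusClassDefs
import Summits.BirchSwinnertonDyer.BirchSwinnertonDyer.Theorems.ErratumRoadFiveEulerHalfPOnlyMultPotMultTwinAtFiveGenusKolyvaginPointsRC
import HarnessLib

/-!
# ErratumRoadFive ∕ EulerHalf ∕ genus line — (b2b-L) `GenusLabelsSupply` FROM THE PRINTED FACTS, per frame with `2` not inert
# (helper, `--supports 23444`)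

Cell bsd-stepL, seat bsd-idea-9 g26 (planner; line owner `genus` on the aside item `stmt-BirchSwinnertonDyer-23444`).
Memo §F.5 ∕ §F.7 ∕ §F.8 (`Cruxes/EulerHalfNotRamNoInertSetAtFive/Lines/genus_gen5_design.md`).

WHAT.  The bridge from the presentation-level theorem `GenusLine.genusLabelsAt_of_facts` (p726922) to the body of the
line's Defs III statement `GenusLine.GenusLabelsSupply` (p726765), in its PROVABLE shape (identification clause guarded by
`c ≠ 0`, `c` coprime to `N_{E′}` — revision Defs III′):
* `genusLabelsSupplyAt_of_presentation` — for a GENERAL globally minimal `W` presented as `C₂ • (D • E′)^{(d₁)} = W` with the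
  genus data of the line's `GenusHeegnerSettingRC` as free variables (pattern of `GenusKolyvaginRC.genusKolyvaginPointsR_of_
  presentation`): `∃ yK ys ε, ShimuraWalk.LabelsAt W N_W K ιc yK ys ε ∧ ∀ c ≠ 0 coprime N_{E′}, ∀ δ : GenusKolyvaginDatum …,
  genusTransport W E′ D C₂ hWd K ιc δ = ± ys c`, GIVEN `d_K % 8 ≠ 5` (`2` not inert: `RingClass.isPrime_span_two_iff`);
* `genusLabelsSupply8_of_printedFacts` — the same ON EVERY GENUS SETTING `S` with the served `FrameProfile`, under the one
  extra hypothesis `NumberField.discr K % 8 ≠ 5` — which the Hoffstein–Luo frame supplies as `d_K ≡ 1 (mod 8)`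
  (`EulerHalfGenusSupply.exists_genusFrame_of_hoffsteinLuo`, conjunct 2) and the frame profile will record as the appended field
  `FrameProfile.d8` (revision A1a′); then `GenusLabelsSupply` (Defs III′) ⟸ this theorem in one line.

HONEST FRAMING: conditional on the three named printed facts (G1) `phi_heegnerPointOfConductor_mem_range_map_ringClassField_birch`,
(B5) `Nekovar2007.cmPoint_frobeniusCongruence`, (B3) `GrossLMS1991.prop53_conj_pinned_birch` (hypotheses); no crux and no stub is
closed; `EulerHalfPOnlyMultPotMultTwinAtFive` is not proved; BSD is proved for no curve.
[cite: GrossLMS1991, §3 Prop. 3.7, §5 Prop. 5.3] [cite: Nekovar2007, Prop. 4.9] [cite: Darmon2004, Thm. 3.6] [cite: Cox2013, §7.D]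
presearch: in-tree only (p726922, p726765, `RingClass.isPrime_span_two_iff`); no new literature.
-/

noncomputable section

open scoped Classical ComplexConjugate

set_option linter.dupNamespace false
set_option autoImplicit false
set_option maxHeartbeats 800000

namespace Summit.BirchSwinnertonDyer.BirchSwinnertonDyer.Theorems.GenusLine

open WeierstrassCurve NumberField Field IsDedekindDomain Literature.NumberTheory.EllipticCurves
  Literature.NumberTheory.EllipticCurves.ModularForms
  Summit.BirchSwinnertonDyer.Rank1Residual.X11b

variable {K : Type} [Field K] [NumberField K]

/-- **(b2b-L) PER PRESENTATION.**  See the module docstring. [cite: GrossLMS1991, §3 Prop. 3.7, §5 Prop. 5.3]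
[cite: Nekovar2007, Prop. 4.9] [cite: Darmon2004, Thm. 3.6] [cite: Cox2013, §7.D] -/
theorem genusLabelsSupplyAt_of_presentation
    (hG1 : ∀ (N : ℕ) [NeZero N] (W : WeierstrassCurve ℚ) (K : Type) [Field K] [NumberField K],
      phi_heegnerPointOfConductor_mem_range_map_ringClassField_birch N W K)
    (hNek : Nekovar2007.cmPoint_frobeniusCongruence)
    (hP53 : ∀ (N : ℕ) [NeZero N] (W : WeierstrassCurve ℚ) (K : Type) [Field K] [NumberField K],
      GrossLMS1991.prop53_conj_pinned_birch N W K)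
    (W : WeierstrassCurve ℚ) [W.IsElliptic] [W.IsGloballyMinimal]
    (hK : IsImaginaryQuadratic K) (h8 : NumberField.discr K % 8 ≠ 5) (ιc : K →+* ℂ)
    (E' : WeierstrassCurve ℚ) [E'.IsElliptic] [E'.IsGloballyMinimal] [NeZero (E'.conductorNorm ℤ)]
    (D C₂ : VariableChange ℚ) [(D • E').IsCharNeTwoNF] {d₁ d₂ : ℤ}
    (hd₁ : (d₁ % 4 = 1 ∧ Squarefree d₁ ∧ d₁ ≠ 1) ∨
      (4 ∣ d₁ ∧ (d₁ / 4 % 4 = 2 ∨ d₁ / 4 % 4 = 3) ∧ Squarefree (d₁ / 4)))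
    (hd₂ : (d₂ % 4 = 1 ∧ Squarefree d₂ ∧ d₂ ≠ 1) ∨
      (4 ∣ d₂ ∧ (d₂ / 4 % 4 = 2 ∨ d₂ / 4 % 4 = 3) ∧ Squarefree (d₂ / 4)))
    (hd : d₁ * d₂ = NumberField.discr K)
    (hE' : ∃ C : VariableChange ℚ, C • W.quadraticTwist (d₁ : ℚ) = E')
    (hWd : C₂ • (D • E').quadraticTwist (d₁ : ℚ) = W)
    (Dt : ModularParametrizationData E' (E'.conductorNorm ℤ)) {β : ℤ}
    (hβ : (4 * (E'.conductorNorm ℤ : ℤ)) ∣ β ^ 2 - NumberField.discr K)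
    {θ : ringClassField K ιc 1} (hθ2 : θ ^ 2 = algebraMap ℚ (ringClassField K ιc 1) (d₁ : ℚ)) (hθ0 : θ ≠ 0)
    (s : ringClassGal ιc 1 → ℤˣ)
    (hθσ : ∀ σ : ringClassGal ιc 1, σ.1 θ = ((s σ : ℤ) : ringClassField K ιc 1) * θ)
    {y : (E'.baseChange (ringClassField K ιc 1)).toAffine.Point}
    (hy : Affine.Point.map (ringClassField K ιc 1).subtype.toRatAlgHom y =
      heegnerPointComplexOfConductor Dt (NumberField.discr K) β 1)
    {instF : Fintype (ringClassGal ιc 1)}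
    {P : (W.baseChange K).toAffine.Point}
    (hP : Affine.Point.map (algebraMap K (ringClassField K ιc 1)).toRatAlgHom P =
      Affine.Point.congrEquiv
        (congrArg (fun X : WeierstrassCurve ℚ ↦ X.baseChange (ringClassField K ιc 1 : Type)) hWd)
        (VariableChange.pointEquivBaseChange ((D • E').quadraticTwist (d₁ : ℚ)) C₂ (ringClassField K ιc 1)
          ((VariableChange.pointEquiv (((D • E').quadraticTwist (d₁ : ℚ)).baseChange
              (ringClassField K ιc 1 : Type)) (untwistAt hθ0)).symm
            ((Affine.Point.congrEquiv (untwistAt_smul_eq (D • E') hθ2 hθ0)).symm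
              (VariableChange.pointEquivBaseChange E' D (ringClassField K ιc 1)
                (∑ τ : ringClassGal ιc 1,
                  (s τ : ℤ) • pointGalHom E' (ringClassField K ιc 1 : Type) τ.1 y)))))) :
    ∃ (yK : (W.baseChange K).toAffine.Point)
      (ys : (m : ℕ) → (W.baseChange (ringClassField K ιc m : Type)).toAffine.Point) (ε : ℤ),
      ShimuraWalk.LabelsAt W (W.conductorNorm ℤ) K ιc yK ys ε ∧
      ∀ (c : ℕ), c ≠ 0 → c.Coprime (E'.conductorNorm ℤ) →
        ∀ (δ : GenusKolyvaginDatum E' K ιc Dt β d₁ c),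
          genusTransport W E' D C₂ hWd K ιc δ = ys c ∨ genusTransport W E' D C₂ hWd K ιc δ = -ys c := by
  subst hWd
  have hD4 : NumberField.discr K < -4 := GenusKolyvaginRC.discr_lt_neg_four_of_genus hK hd₁ hd₂ hd
  have hd₁K : d₁ ∣ NumberField.discr K := hd ▸ dvd_mul_right d₁ d₂
  have h2 : ∀ ℓ : ℕ, ℓ.Prime → (Ideal.span {(ℓ : 𝓞 K)}).IsPrime →
      ¬ ℓ ∣ (C₂ • (D • E').quadraticTwist (d₁ : ℚ)).conductorNorm ℤ → ℓ ≠ 2 := by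
    rintro ℓ - hinert - rfl
    exact h8 ((Literature.NumberTheory.QuadraticFields.RingClass.isPrime_span_two_iff hK.1).mp hinert)
  obtain ⟨ys, ε, hL, hid⟩ :=
    genusLabelsAt_of_facts hG1 hNek hP53 hK hD4 ιc E' D C₂ d₁ hE' hd₁K Dt hβ hθ2 hθ0 s hθσ hy hP h2
  exact ⟨P, ys, ε, hL, fun c hc hcN δ ↦ hid c hc hcN δ.hϑ2 δ.hϑ0 δ.hQ⟩

/-- **(b2b-L) ON EVERY SERVED FRAME WITH `2` NOT INERT** — the body of `GenusLine.GenusLabelsSupply` (Defs III′ shape) for the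
setting `S` and the served `FrameProfile`, under `d_K % 8 ≠ 5` (= the frame's `d_K ≡ 1 (mod 8)`, appended field `FrameProfile.d8`
of revision A1a′; until then an explicit hypothesis). [cite: GrossLMS1991, §3 Prop. 3.7, §5 Prop. 5.3] [cite: Nekovar2007, Prop. 4.9]
[cite: Darmon2004, Thm. 3.6] -/
theorem genusLabelsSupply8_of_printedFacts
    (hG1 : ∀ (N : ℕ) [NeZero N] (W : WeierstrassCurve ℚ) (K : Type) [Field K] [NumberField K],
      phi_heegnerPointOfConductor_mem_range_map_ringClassField_birch N W K)
    (hNek : Nekovar2007.cmPoint_frobeniusCongruence)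
    (hP53 : ∀ (N : ℕ) [NeZero N] (W : WeierstrassCurve ℚ) (K : Type) [Field K] [NumberField K],
      GrossLMS1991.prop53_conj_pinned_birch N W K)
    (W : WeierstrassCurve ℚ) [W.IsElliptic] [W.IsGloballyMinimal]
    (A : WeierstrassCurve ℚ) [A.IsElliptic] [A.IsGloballyMinimal] (p q : ℕ) [Fact p.Prime] [Fact q.Prime]
    (K : Type) [Field K] [NumberField K] (S : GenusHeegnerSettingRC W A p q K) (hprof : FrameProfile W A p q K)
    (h8 : NumberField.discr K % 8 ≠ 5) :
    haveI := S.ell; haveI := S.min; haveI := S.nz; haveI := S.nf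
    ∃ (yK : (W.baseChange K).toAffine.Point)
      (ys : (m : ℕ) → (W.baseChange (ringClassField K S.ιc m : Type)).toAffine.Point) (ε : ℤ),
      ShimuraWalk.LabelsAt W (W.conductorNorm ℤ) K S.ιc yK ys ε ∧
      ∀ (c : ℕ), c ≠ 0 → c.Coprime (S.E'.conductorNorm ℤ) →
        ∀ (δ : GenusKolyvaginDatum S.E' K S.ιc S.Dt S.β S.d₁ c),
          genusTransport W S.E' S.D S.C₂ S.hWd K S.ιc δ = ys c ∨
            genusTransport W S.E' S.D S.C₂ S.hWd K S.ιc δ = -ys c := by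
  haveI := S.ell; haveI := S.min; haveI := S.nz; haveI := S.nf
  exact genusLabelsSupplyAt_of_presentation hG1 hNek hP53 W hprof.quad h8 S.ιc S.E' S.D S.C₂ S.hd₁ S.hd₂ S.hd S.hE'
    S.hWd S.Dt S.hβ S.hθ2 S.hθ0 S.s S.hθσ S.hy S.hP

end Summit.BirchSwinnertonDyer.BirchSwinnertonDyer.Theorems.GenusLine

end
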